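/-
Copyright: the b2b-balaban T⁴-continuum CRUX team, row NE7b leaf lineage `t4-ne7b-formalise-leaf-01` (gen 84). Project licence.
-/
import Mathlib.Algebra.Order.BigOperators.Ring.Finset
import Mathlib.Algebra.Order.Chebyshev
import Mathlib.Data.Matrix.Mul
import Mathlib.Data.Real.Basic
import Mathlib.Tactic.FieldSimp
import Mathlib.Tactic.FinCases
import Mathlib.Tactic.Linarith
import Mathlib.Tactic.Positivity
import Mathlib.Tactic.Ring

/-!
# THE BLOCK AVERAGE AND ITS RIGHT INVERSE, BY VALUE: for a block map `blk : n → m` with fibres of size in `[N_min, N_max]` (`N_min ≥ 1`), the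
# block AVERAGE `Q` and the block-CONSTANT extension `M` satisfy `QM = 1`, `(Mλ)(x) = λ(blk x)`, `‖Mλ‖² ≤ N_max‖λ‖²`, `‖Qᵀλ‖² ≤ N_min⁻¹‖λ‖²`,
# Jensen `Σ_y #fibre·(QA)_y² ≤ ‖A‖²` — and with `S ≤ Γ` the three right-inverse letters of `…SchurPairFromLetters` hold with `C := ΓN_max`,
# `q := N_min⁻¹` (row NE7b, node U5c; the `U = 1` right inverse of the unit-lattice averaging as NUMBERS — SPFL's NOT-HERE «the right inverse `M` of
# `Q_b` BY VALUE (`Q_bQ_bᵀ ∝ 1` for print's block average)»; [folklore] fibrewise sums + Cauchy–Schwarz against `1`)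

Cell `pub-balaban`, sub-cell `t4`, spine estimate NE7b (`T4WeightBudget.RelWeightBound`; the cell's OWN estimate — NOT PRINTED in
[Bałaban 1983–89], NOT PROVED).  Crux-route work under `Spine/NE7b/` by a row leaf (`t4-ne7b-formalise-leaf-01` gen 84) on the windowed
convexity road (R-P1) under FREEZE (0)'s crux-prover clause; NOTHING of Bałaban's is named as a Lean object, valued or asserted; no
`T4Continuum/Support` leaf typed; no `def` — the two matrices are CARRIED BY THEIR CHARACTERISING HYPOTHESES
(`hQ : Q y x = if blk x = y then #fibre(y)⁻¹ else 0`, `hM : M x y = if blk x = y then 1 else 0`, the pattern of `…TorusPlaquetteIncidence`'s `ι`),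
inhabited by `Matrix.of` in the toy; zero `sorry`.  Imports: Mathlib only — independent of the hub's olean frontier; the consumer
`…SchurPairFromLetters` (this lineage, p382653 ✓, no hub olean yet) is met BY SHAPE.

WHY.  `…SchurPairFromLetters` (SPFL) turns the two invertibility letters of the Schur pair `(H, P)` into theorems GIVEN an exact right inverse
`M` of the averaging `Q` with an energy letter `⟨Mλ, SMλ⟩ ≤ C‖λ‖²` and, for the floor of `P`, the adjoint letter `‖Qᵀλ‖² ≤ q‖λ‖²`; its NOT-HERE
reads «the right inverse `M` of `Q_b` BY VALUE (`Q_bQ_bᵀ ∝ 1` for print's block average — the dictionary's, not here)», and the pricing desk lists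
«`‖Q‖, ‖M‖`» among the letters owed by value.  At `U = 1` print's unit-lattice averaging IS a block average over the fibres of a block map ([B5]
(1.7)–(1.9); for `U ≠ 1` the composed covariant average `Q_k(U)` has only an APPROXIMATE right inverse — r1-g3's `QGQ-inverse-proof.md`, covered in
shape by `QGQInverse.qgq_coercive_of_approx_right_inverse` with `θ > 0`).  THIS FILE values the `U = 1` letters for ANY block map with fibre sizes
in `[N_min, N_max]`: the block-constant extension `M` is an EXACT right inverse, `‖M‖² ≤ N_max`, `‖Qᵀ‖² ≤ N_min⁻¹`, `‖Q‖ ≤ 1` (Jensen) — in the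
UNWEIGHTED `dotProduct` currency of SPFL ∕ `B9SectEKernel` (in the `η^d`-weighted `L²(Ω_k)` currency all three are `1`; the weights are the
consumer's normalisation, (A3)).

WHAT IS PROVED ([folklore]; `blk : n → m`, fibres `univ.filter (blk · = y)`):
* §1 FIBRE SUMS: `sum_eq_sum_fibre`, `sum_comp_blk` (`Σ_x h(blk x) = Σ_y #fibre(y)·h y`), `sum_ite_blk_eq`.
* §2 THE LETTERS (`Q`, `M` by their characterising hypotheses): `M_mulVec_apply` (`(Mλ)(x) = λ(blk x)`), `Q_mulVec_apply` (`(QA)(y) = #fibre⁻¹·Σ_{fibre}A`),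
  **`Q_mul_M_eq_one`** (inhabited fibres ⊢ `QM = 1`), **`M_normSq_le`** (`‖Mλ‖² ≤ N_max‖λ‖²`), `Qt_mulVec_apply`, **`Qt_normSq_le`**
  (`‖Qᵀλ‖² ≤ N_min⁻¹‖λ‖²`), **`Q_normSq_weighted_le`** (Jensen: `Σ_y #fibre(y)·(QA)_y² ≤ A ⬝ᵥ A`), `Q_normSq_le` (`‖QA‖² ≤ ‖A‖²`).
* §3 THE END IN SPFL's BINDERS: **`schurPair_letters_blockAverage`** — `N_min ≥ 1`, fibres in `[N_min, N_max]`, `⟨v, Sv⟩ ≤ Γ‖v‖²` (`Γ ≥ 0`) ⊢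
  `QM = 1 ∧ (∀ λ, ⟨Mλ, SMλ⟩ ≤ ΓN_max‖λ‖²) ∧ (∀ λ, ‖Qᵀλ‖² ≤ N_min⁻¹‖λ‖²)` — verbatim SPFL's `hQM`, `hE` (`C := ΓN_max`), `hQ` (`q := N_min⁻¹`); so there
  `QS⁻¹Qᵀ` is `(ΓN_max)⁻¹`-coercive and `γN_min ≤ (QS⁻¹Qᵀ)⁻¹ ≤ ΓN_max` as forms.
* §4 toy (kernel): `Fin 4 → Fin 2`, two blocks of two — `QM = 1` for the `Matrix.of` instances.

NOT HERE (honest): WHICH block map is print's at step `k` (the `L^k`-blocks of `T_η` over `T₁^{(k)}`, `N_min = N_max = L^{dk}`), the `η^d` ∕ `L^{−dk}`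
normalisations of print's `Q_k`, `Q_k*` ((A3) ∕ (A1c), NC-NE7b-α UNRULED); the covariant `U ≠ 1` averaging (approximate right inverse only);
the fine operator's ceiling `Γ` BY VALUE; the junction with SPFL BY IMPORT (no hub olean — BY SHAPE).  BY-NAME EFFECT ON THE WALL: NONE (three
displayed letters of the (ℓ1) socket become fibre counts at `U = 1`; the wall is (R2)).  NE7b NOT PRINTED ∕ NOT PROVED; spine PROVED 0∕9; rung
(B)+1 on a FINITE torus — NOT infinite volume, NOT the mass gap, NOT Clay.  HONEST DEPENDENCY: continuum YM on T⁴ ⇐ BetaPertH ∧ nine spine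
estimates (0∕9 proved); BetaPertH ⇐ (D1) ∧ (D4) ∧ CAP+tail; G-an2-4 gates asym, D1 and NE2∕3∕4.
-/

set_option autoImplicit false

open Finset Matrix

namespace Summit.QuantumFields.BalabanUV.T4Continuum.NE7b.BlockAverageLetters

variable {n m : Type*} [Fintype n] [DecidableEq n] [Fintype m] [DecidableEq m]

/-! ## §1 Fibre sums of a block map -/

section Fibre

variable (blk : n → m)

omit [DecidableEq n] in
/-- A sum over the fine index is a sum over blocks of sums over fibres. [folklore] -/
theorem sum_eq_sum_fibre (g : n → ℝ) : ∑ x, g x = ∑ y, ∑ x ∈ univ.filter (fun x => blk x = y), g x := by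
  rw [← sum_fiberwise_of_maps_to (s := (univ : Finset n)) (t := (univ : Finset m)) (g := blk) (fun x _ => mem_univ _) g]

omit [DecidableEq n] in
/-- The sum over the fine index of a function of the block is the fibre-size-weighted coarse sum: `Σ_x h(blk x) = Σ_y #fibre(y)·h y`. [folklore] -/
theorem sum_comp_blk (h : m → ℝ) : ∑ x, h (blk x) = ∑ y, ((univ.filter fun x => blk x = y).card : ℝ) * h y := by
  rw [sum_eq_sum_fibre blk]
  refine sum_congr rfl fun y _ => ?_
  rw [sum_congr rfl fun x hx => by rw [(mem_filter.1 hx).2], sum_const, nsmul_eq_mul]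

omit [DecidableEq n] [Fintype m] in
/-- `Σ_x 𝟙[blk x = y]·g x = Σ_{fibre y} g x`. [folklore] -/
theorem sum_ite_blk_eq (y : m) (g : n → ℝ) : ∑ x, (if blk x = y then g x else 0) = ∑ x ∈ univ.filter (fun x => blk x = y), g x := by
  rw [sum_filter]

end Fibre

/-! ## §2 The block average `Q` and its piecewise-constant right inverse `M`, carried by their characterising hypotheses -/

section Letters

variable (blk : n → m) (Q : Matrix m n ℝ) (M : Matrix n m ℝ)
  (hQ : ∀ y x, Q y x = if blk x = y then (((univ.filter fun x' => blk x' = y).card : ℝ))⁻¹ else 0)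
  (hM : ∀ x y, M x y = if blk x = y then 1 else 0)

include hM in
omit [Fintype n] [DecidableEq n] in
/-- `(Mλ)(x) = λ(blk x)`: `M` extends a coarse field as a constant on each block. [folklore] -/
theorem M_mulVec_apply (lam : m → ℝ) (x : n) : (M *ᵥ lam) x = lam (blk x) := by
  simp only [mulVec, dotProduct, hM, ite_mul, one_mul, zero_mul, sum_ite_eq, mem_univ, if_true]

include hQ in
omit [DecidableEq n] [Fintype m] in
/-- `(QA)(y) = #fibre(y)⁻¹ · Σ_{fibre y} A x`: `Q` is the block AVERAGE. [folklore] -/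
theorem Q_mulVec_apply (A : n → ℝ) (y : m) :
    (Q *ᵥ A) y = (((univ.filter fun x => blk x = y).card : ℝ))⁻¹ * ∑ x ∈ univ.filter (fun x => blk x = y), A x := by
  simp only [mulVec, dotProduct, hQ, ite_mul, zero_mul]
  rw [sum_ite_blk_eq blk y, mul_sum]

include hQ hM in
omit [DecidableEq n] [Fintype m] in
/-- **`QM = 1`** when every fibre is inhabited: the block average of a block-constant field returns the field. [folklore] -/
theorem Q_mul_M_eq_one (hfib : ∀ y, 0 < (univ.filter fun x => blk x = y).card) : Q * M = 1 := by
  ext y y'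
  rw [Matrix.mul_apply]
  have e : ∀ x, Q y x * M x y' =
      if blk x = y then (((univ.filter fun x' => blk x' = y).card : ℝ))⁻¹ * (if y = y' then 1 else 0) else 0 := by
    intro x
    rw [hQ, hM]
    by_cases h1 : blk x = y
    · subst h1; simp
    · simp [h1]
  rw [sum_congr rfl fun x _ => e x, sum_ite_blk_eq blk y, sum_const, nsmul_eq_mul, ← mul_assoc,
    mul_inv_cancel₀ (Nat.cast_pos.mpr (hfib y)).ne', one_mul, Matrix.one_apply]

include hM in
omit [DecidableEq n] in
/-- **THE NORM OF THE RIGHT INVERSE**: `‖Mλ‖² = Σ_y #fibre(y)·λ_y²`, hence `≤ N_max·‖λ‖²` when every fibre has `≤ N_max` points. [folklore] -/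
theorem M_normSq_le (lam : m → ℝ) {Nmax : ℕ} (hmax : ∀ y, (univ.filter fun x => blk x = y).card ≤ Nmax) :
    (M *ᵥ lam) ⬝ᵥ (M *ᵥ lam) ≤ Nmax * (lam ⬝ᵥ lam) := by
  have e : (M *ᵥ lam) ⬝ᵥ (M *ᵥ lam) = ∑ y, ((univ.filter fun x => blk x = y).card : ℝ) * (lam y * lam y) := by
    simp only [dotProduct, M_mulVec_apply blk M hM]
    exact sum_comp_blk blk (fun y => lam y * lam y)
  rw [e, dotProduct, mul_sum]
  exact sum_le_sum fun y _ => mul_le_mul_of_nonneg_right (by exact_mod_cast hmax y) (mul_self_nonneg _)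

include hQ in
omit [DecidableEq n] in
/-- `(Qᵀλ)(x) = #fibre(blk x)⁻¹ · λ(blk x)`. [folklore] -/
theorem Qt_mulVec_apply (lam : m → ℝ) (x : n) :
    (Qᵀ *ᵥ lam) x = (((univ.filter fun x' => blk x' = blk x).card : ℝ))⁻¹ * lam (blk x) := by
  simp only [mulVec, dotProduct, transpose_apply, hQ]
  rw [Finset.sum_eq_single (blk x)]
  · simp
  · intro y _ hy; rw [if_neg (Ne.symm hy), zero_mul]
  · intro h; exact absurd (mem_univ _) h

include hQ in
omit [DecidableEq n] in
/-- **THE NORM OF THE ADJOINT**: `‖Qᵀλ‖² = Σ_y λ_y²∕#fibre(y)` (over inhabited fibres), hence `≤ N_min⁻¹·‖λ‖²` when every fibre has `≥ N_min ≥ 1` points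
— the `q` letter of `…SchurPairFromLetters.form_qsq_le`. [folklore] -/
theorem Qt_normSq_le (lam : m → ℝ) {Nmin : ℕ} (hNmin : 0 < Nmin) (hmin : ∀ y, Nmin ≤ (univ.filter fun x => blk x = y).card) :
    (Qᵀ *ᵥ lam) ⬝ᵥ (Qᵀ *ᵥ lam) ≤ (Nmin : ℝ)⁻¹ * (lam ⬝ᵥ lam) := by
  have hN : ∀ y, (0 : ℝ) < ((univ.filter fun x => blk x = y).card : ℝ) := fun y => by exact_mod_cast hNmin.trans_le (hmin y)
  have e : (Qᵀ *ᵥ lam) ⬝ᵥ (Qᵀ *ᵥ lam) =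
      ∑ y, ((univ.filter fun x => blk x = y).card : ℝ) * ((((univ.filter fun x => blk x = y).card : ℝ))⁻¹ * lam y) ^ 2 := by
    simp only [dotProduct, Qt_mulVec_apply blk Q hQ, ← pow_two]
    exact sum_comp_blk blk (fun y => ((((univ.filter fun x => blk x = y).card : ℝ))⁻¹ * lam y) ^ 2)
  rw [e, dotProduct, mul_sum]
  refine sum_le_sum fun y _ => ?_
  have hNy := hN y
  have h1 : ((univ.filter fun x => blk x = y).card : ℝ) * ((((univ.filter fun x => blk x = y).card : ℝ))⁻¹ * lam y) ^ 2
      = (((univ.filter fun x => blk x = y).card : ℝ))⁻¹ * (lam y * lam y) := by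
    field_simp
  rw [h1]
  exact mul_le_mul_of_nonneg_right ((inv_le_inv₀ hNy (by exact_mod_cast hNmin)).mpr (by exact_mod_cast hmin y)) (mul_self_nonneg _)

include hQ in
omit [DecidableEq n] in
/-- **JENSEN FOR THE BLOCK AVERAGE**: `Σ_y #fibre(y)·(QA)_y² ≤ Σ_x A_x²` (the averaged field, weighted by the block sizes, has no more `ℓ²` mass than the
field) — in particular `‖QA‖² ≤ ‖A‖²`. [folklore] -/
theorem Q_normSq_weighted_le (A : n → ℝ) :
    ∑ y, ((univ.filter fun x => blk x = y).card : ℝ) * (Q *ᵥ A) y ^ 2 ≤ A ⬝ᵥ A := by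
  have hA : A ⬝ᵥ A = ∑ y, ∑ x ∈ univ.filter (fun x => blk x = y), A x ^ 2 := by
    simp only [dotProduct, ← pow_two]; exact sum_eq_sum_fibre blk _
  rw [hA]
  refine sum_le_sum fun y _ => ?_
  set s := univ.filter (fun x => blk x = y) with hs
  rw [Q_mulVec_apply blk Q hQ A y]
  rcases Nat.eq_zero_or_pos s.card with h0 | hpos
  · have : s = ∅ := Finset.card_eq_zero.mp h0
    simp [this]
  · have hc : (0 : ℝ) < s.card := by exact_mod_cast hpos
    -- (Σ A)² ≤ #s · Σ A²
    have hcs : (∑ x ∈ s, A x) ^ 2 ≤ s.card * ∑ x ∈ s, A x ^ 2 := sq_sum_le_card_mul_sum_sq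
    calc (s.card : ℝ) * ((s.card : ℝ)⁻¹ * ∑ x ∈ s, A x) ^ 2 = (s.card : ℝ)⁻¹ * (∑ x ∈ s, A x) ^ 2 := by field_simp
      _ ≤ (s.card : ℝ)⁻¹ * (s.card * ∑ x ∈ s, A x ^ 2) := mul_le_mul_of_nonneg_left hcs (inv_nonneg.mpr hc.le)
      _ = ∑ x ∈ s, A x ^ 2 := by field_simp

include hQ in
omit [DecidableEq n] in
/-- `‖QA‖² ≤ ‖A‖²` (each inhabited fibre has `#fibre ≥ 1`; empty fibres average to `0`). [folklore] -/
theorem Q_normSq_le (A : n → ℝ) : (Q *ᵥ A) ⬝ᵥ (Q *ᵥ A) ≤ A ⬝ᵥ A := by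
  refine le_trans ?_ (Q_normSq_weighted_le blk Q hQ A)
  rw [dotProduct]
  refine sum_le_sum fun y _ => ?_
  rw [← pow_two]
  rcases Nat.eq_zero_or_pos (univ.filter fun x => blk x = y).card with h0 | hpos
  · have : univ.filter (fun x => blk x = y) = ∅ := Finset.card_eq_zero.mp h0
    rw [Q_mulVec_apply blk Q hQ A y, this]
    simp
  · have h1 : (1 : ℝ) ≤ (univ.filter fun x => blk x = y).card := by exact_mod_cast hpos
    exact le_mul_of_one_le_left (sq_nonneg _) h1

end Letters

/-! ## §3 The END in `…SchurPairFromLetters`' binders: the right-inverse letters of the block average BY VALUE -/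

section End

variable (blk : n → m) (Q : Matrix m n ℝ) (M : Matrix n m ℝ)
  (hQ : ∀ y x, Q y x = if blk x = y then (((univ.filter fun x' => blk x' = y).card : ℝ))⁻¹ else 0)
  (hM : ∀ x y, M x y = if blk x = y then 1 else 0)

include hQ hM in
omit [DecidableEq n] in
/-- **THE RIGHT-INVERSE LETTERS OF THE BLOCK AVERAGE, BY VALUE** — the three binders `hQM ∕ hE ∕ hQ` of `…SchurPairFromLetters`
(`coercive_qsq_of_right_inverse`, `form_P_two_sided`) for `Q` = the block average over the fibres of `blk : n → m` and `M` = the block-constant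
extension: if every fibre has between `N_min ≥ 1` and `N_max` points and the fine operator obeys `⟨v, Sv⟩ ≤ Γ‖v‖²` (`Γ ≥ 0`), then
`QM = 1`, `⟨Mλ, SMλ⟩ ≤ Γ·N_max·‖λ‖²` (so `C := ΓN_max`) and `‖Qᵀλ‖² ≤ N_min⁻¹‖λ‖²` (so `q := N_min⁻¹`) — whence, in that file, `QS⁻¹Qᵀ` is
`(ΓN_max)⁻¹`-coercive and `γN_min ≤ P ≤ ΓN_max` for the coarse precision `P = (QS⁻¹Qᵀ)⁻¹`. [folklore] -/
theorem schurPair_letters_blockAverage {Nmin Nmax : ℕ} (hNmin : 0 < Nmin)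
    (hmin : ∀ y, Nmin ≤ (univ.filter fun x => blk x = y).card) (hmax : ∀ y, (univ.filter fun x => blk x = y).card ≤ Nmax)
    (S : Matrix n n ℝ) {Γ : ℝ} (hΓ0 : 0 ≤ Γ) (hΓ : ∀ v : n → ℝ, v ⬝ᵥ (S *ᵥ v) ≤ Γ * (v ⬝ᵥ v)) :
    Q * M = 1 ∧ (∀ lam : m → ℝ, (M *ᵥ lam) ⬝ᵥ (S *ᵥ (M *ᵥ lam)) ≤ Γ * Nmax * (lam ⬝ᵥ lam)) ∧
      (∀ lam : m → ℝ, (Qᵀ *ᵥ lam) ⬝ᵥ (Qᵀ *ᵥ lam) ≤ (Nmin : ℝ)⁻¹ * (lam ⬝ᵥ lam)) := by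
  refine ⟨Q_mul_M_eq_one blk Q M hQ hM fun y => hNmin.trans_le (hmin y), fun lam => ?_, fun lam => Qt_normSq_le blk Q hQ lam hNmin hmin⟩
  calc (M *ᵥ lam) ⬝ᵥ (S *ᵥ (M *ᵥ lam)) ≤ Γ * ((M *ᵥ lam) ⬝ᵥ (M *ᵥ lam)) := hΓ _
    _ ≤ Γ * (Nmax * (lam ⬝ᵥ lam)) := mul_le_mul_of_nonneg_left (M_normSq_le blk M hM lam hmax) hΓ0
    _ = Γ * Nmax * (lam ⬝ᵥ lam) := by ring

end End

/-! ## §4 Toy (kernel): four fine points in two blocks of two -/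

/-- Toy: `n = Fin 4`, `m = Fin 2`, `blk x = x ∕ 2` (two blocks of two points); the block average of the block-constant extension of
`λ` is `λ`: `QM = 1`. -/
example : (Matrix.of fun (y : Fin 2) (x : Fin 4) =>
      if (fun x : Fin 4 => (⟨x.val / 2, by omega⟩ : Fin 2)) x = y
      then (((univ.filter fun x' : Fin 4 => (fun x : Fin 4 => (⟨x.val / 2, by omega⟩ : Fin 2)) x' = y).card : ℝ))⁻¹ else 0) *
    (Matrix.of fun (x : Fin 4) (y : Fin 2) => if (fun x : Fin 4 => (⟨x.val / 2, by omega⟩ : Fin 2)) x = y then (1 : ℝ) else 0) = 1 :=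
  Q_mul_M_eq_one (fun x : Fin 4 => (⟨x.val / 2, by omega⟩ : Fin 2)) _ _ (fun _ _ => rfl) (fun _ _ => rfl)
    (fun y => by fin_cases y <;> decide)

end Summit.QuantumFields.BalabanUV.T4Continuum.NE7b.BlockAverageLetters
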